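import Summits.AtomisticToContinuum.Crystallization.Theorems.ChargedEnergyGapConeCount
import HarnessLib

/-!
# Charged energy gap — lens-3 g64, node «BarlowRef» (R3) — part 16 (addendum; imports part 15 `…ConeCount`, land after it): the CONE TAIL (closed form for the far targets of one source) + the HALF-ANNULUS count

The per-band certificate of `TubeShareBoundH` (g65 item 2) bounds, for each source `y` in the tube regime (`a = dist y c > r`), the target sum
`Σ_{z} (dist y z)⁻⁶` over the shadow cone of slope `κ = r/√(a² − r²)` (part 15 `radial_sq_le_of_shadow`) by finitely many EXPLICIT axial classes
(part 15 `card_mul_le_cone_of_subset_image`).  The numerical model (`num/cert64.py`) silently truncates at axial distance ≈ 10⁴; a proof needs the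
TAIL beyond the last explicit class in closed form, with the cone's `κ²` scaling (an isotropic packing tail would force the explicit classes out to
axial distance ≈ 3000 for far sources).  This part proves it by dyadic axial shells + part 15's frustum count + a geometric series:

* `coneVol_le_cylinder` — `coneVol κ m α β ≤ π (β − α) (κβ + m)²` for `0 ≤ κ`, `0 ≤ m`, `|α| ≤ β`;
* ★ `cone_shell_sum_mul_le` — one dyadic shell: targets `T ⊆ g '' barlowStacking a h s` with axial part `∈ [X, 2X]` (`X ≥ 18/5`) inside the cone of
  slope `κ` with vertex `y` satisfy `(Σ_{z ∈ T} (dist y z)⁻¹^6) · a(a√3/2)h ≤ 16π κ²/X³ + 4π ((2κ + 1)·9/5)²/X⁵`;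
* ★★ `cone_tail_sum_mul_le` — all targets of axial part `≥ U` (`U ≥ 18/5`) in the cone:
  `(Σ_{z ∈ T} (dist y z)⁻¹^6) · a(a√3/2)h ≤ (128π/7) κ²/U³ + (128π/31) ((2κ + 1)·9/5)²/U⁵`
  (the second, `κ`-free term is the `9/5`-thickening of the cone's axis — a needle still meets lattice rows; it is `< 10⁻⁹` of the first at the
  record slopes and `U ≥ 60`).

Also (section `CapAnnulus`, the INSIDE regime `r < a ≤ 2r` of the certificate): `volume_capAnnulus_le` and ★★ `card_mul_le_capAnnulus_of_subset_image`
— targets with `τ ≤ ⟪b 2, z − y⟫` and `R₁ ≤ dist z y ≤ R₂` satisfy `#T · a(a√3/2)h ≤ capVol (R₂ + 9/5) (τ − 9/5) − capVol (R₁ − 9/5) (τ − 9/5)`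
(exact thickened half-annulus for `τ = 0`; `num/cert64.py`'s «half-ball cumulative annulus counts»).

0 sorry; standard axioms.
-/

noncomputable section

open scoped Classical RealInnerProductSpace ENNReal
open MeasureTheory
open Literature.MathematicalPhysics.StatisticalMechanics Literature.Geometry.DiscreteGeometry
open Summit.AtomisticToContinuum.Crystallization.Theses.PricedLinkCensus
open Summit.AtomisticToContinuum.Crystallization.Theorems.ChargedEnergyGapNegative

namespace Summit.AtomisticToContinuum.Crystallization.Theorems.ChargedEnergyGapChartDial

section ConeTail

/-- The frustum volume is at most the cylinder volume at the larger radius: `coneVol κ m α β ≤ π (β − α)(κβ + m)²` (`0 ≤ κ`, `0 ≤ m`, `|α| ≤ β`). -/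
theorem coneVol_le_cylinder {κ m α β : ℝ} (hκ : 0 ≤ κ) (hm : 0 ≤ m) (hαβ : |α| ≤ β) :
    coneVol κ m α β ≤ Real.pi * (β - α) * (κ * β + m) ^ 2 := by
  have hα := abs_le.1 hαβ
  have hβ : 0 ≤ β := (abs_nonneg α).trans hαβ
  have e : coneVol κ m α β = Real.pi * (β - α) * (κ ^ 2 * (β ^ 2 + α * β + α ^ 2) / 3 + κ * m * (β + α) + m ^ 2) := by
    unfold coneVol; ring
  rw [e]
  have hba : 0 ≤ β - α := by linarith
  refine mul_le_mul_of_nonneg_left ?_ (mul_nonneg Real.pi_pos.le hba)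
  have h1 : κ ^ 2 * (β ^ 2 + α * β + α ^ 2) / 3 ≤ κ ^ 2 * β ^ 2 := by
    have : β ^ 2 + α * β + α ^ 2 ≤ 3 * β ^ 2 := by nlinarith
    have hk2 : 0 ≤ κ ^ 2 := sq_nonneg κ
    nlinarith
  have h2 : κ * m * (β + α) ≤ 2 * (κ * m * β) := by
    have hkm : 0 ≤ κ * m := mul_nonneg hκ hm
    nlinarith
  nlinarith [h1, h2]

/-- The axial part of `z − y` along a unit vector is at most `dist y z`. -/
theorem inner_axis_le_dist (b : OrthonormalBasis (Fin 3) ℝ E3) (y z : E3) : ⟪b 2, z - y⟫ ≤ dist y z := by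
  calc ⟪b 2, z - y⟫ ≤ ‖b 2‖ * ‖z - y‖ := real_inner_le_norm _ _
    _ = dist y z := by rw [b.orthonormal.1 2, one_mul, dist_eq_norm, norm_sub_rev]

/-- ★ ONE DYADIC SHELL of the cone tail: window `(a,h)`, `g` isometry, cone of slope `κ ≥ 0` with vertex `y` about `b 2`, finite
`T ⊆ g '' barlowStacking a h s` whose members have axial part in `[X, 2X]` (`X ≥ 18/5`) and radial part `≤ κ · axial` ⟹
`(Σ_{z ∈ T} (dist y z)⁻¹^6) · a(a√3/2)h ≤ 16π κ²/X³ + 4π((2κ + 1)·9/5)²/X⁵`. -/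
theorem cone_shell_sum_mul_le {a h : ℝ} {s : ℤ → ℤ} {g : E3 → E3}
    (ha : 9 / 10 ≤ a ∧ a ≤ 11 / 10) (hh : 0 < h ∧ 27 / 50 * a ^ 2 ≤ h ^ 2 ∧ h ^ 2 ≤ 121 / 150 * a ^ 2) (hg : Isometry g)
    (b : OrthonormalBasis (Fin 3) ℝ E3) (y : E3) {κ X : ℝ} (hκ : 0 ≤ κ) (hX : 18 / 5 ≤ X)
    (T : Finset E3) (hT : ↑T ⊆ g '' barlowStacking a h s)
    (hcone : ∀ z ∈ T, X ≤ ⟪b 2, z - y⟫ ∧ ⟪b 2, z - y⟫ ≤ 2 * X ∧ ⟪b 0, z - y⟫ ^ 2 + ⟪b 1, z - y⟫ ^ 2 ≤ (κ * ⟪b 2, z - y⟫) ^ 2) :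
    (∑ z ∈ T, (dist y z)⁻¹ ^ 6) * (a * (a * √3 / 2) * h) ≤
      16 * Real.pi * κ ^ 2 / X ^ 3 + 4 * Real.pi * ((2 * κ + 1) * (9 / 5)) ^ 2 / X ^ 5 := by
  have hX0 : 0 < X := by linarith
  have ha0 : 0 ≤ a := by linarith [ha.1]
  have hV0 : 0 ≤ a * (a * √3 / 2) * h := by have := hh.1.le; positivity
  -- the shell lies in the frustum `orthoCone b y X (2X) κ 0`
  have hT' : ↑T ⊆ g '' barlowStacking a h s ∩ orthoCone b y X (2 * X) κ 0 := by
    intro z hz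
    refine ⟨hT hz, ?_⟩
    obtain ⟨h1, h2, h3⟩ := hcone z hz
    rw [mem_orthoCone_iff]
    exact ⟨h1, h2, by rwa [add_zero]⟩
  have hcount := card_mul_le_cone_of_subset_image ha hh hg b y hκ (by rw [add_zero]; exact mul_nonneg hκ hX0.le) (by linarith) T hT'
  -- each weight is at most `X⁻⁶`
  have hw : ∀ z ∈ T, (dist y z)⁻¹ ^ 6 ≤ X⁻¹ ^ 6 := by
    intro z hz
    have hle : X ≤ dist y z := (hcone z hz).1.trans (inner_axis_le_dist b y z)
    exact pow_le_pow_left₀ (inv_nonneg.2 dist_nonneg) (inv_anti₀ hX0 hle) 6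
  have hsum : ∑ z ∈ T, (dist y z)⁻¹ ^ 6 ≤ T.card * X⁻¹ ^ 6 := by
    calc ∑ z ∈ T, (dist y z)⁻¹ ^ 6 ≤ ∑ z ∈ T, X⁻¹ ^ 6 := Finset.sum_le_sum hw
      _ = T.card * X⁻¹ ^ 6 := by rw [Finset.sum_const, nsmul_eq_mul]
  -- frustum ≤ cylinder, then the elementary estimate
  set m : ℝ := 0 + (κ + 1) * (9 / 5) with hm
  have hm0 : 0 ≤ m := by rw [hm]; positivity
  have hcyl : coneVol κ m (X - 9 / 5) (2 * X + 9 / 5) ≤ Real.pi * (2 * X + 9 / 5 - (X - 9 / 5)) * (κ * (2 * X + 9 / 5) + m) ^ 2 :=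
    coneVol_le_cylinder hκ hm0 (by rw [abs_le]; constructor <;> linarith)
  have hrad : (κ * (2 * X + 9 / 5) + m) ^ 2 ≤ 2 * (2 * κ * X) ^ 2 + 2 * ((2 * κ + 1) * (9 / 5)) ^ 2 := by
    have e : κ * (2 * X + 9 / 5) + m = 2 * κ * X + (2 * κ + 1) * (9 / 5) := by rw [hm]; ring
    rw [e]
    nlinarith [sq_nonneg (2 * κ * X - (2 * κ + 1) * (9 / 5))]
  have hlen : 2 * X + 9 / 5 - (X - 9 / 5) ≤ 2 * X := by linarith
  have hCV : coneVol κ m (X - 9 / 5) (2 * X + 9 / 5) ≤ Real.pi * (2 * X) * (2 * (2 * κ * X) ^ 2 + 2 * ((2 * κ + 1) * (9 / 5)) ^ 2) := by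
    refine hcyl.trans ?_
    have hπ := Real.pi_pos.le
    have h1 : Real.pi * (2 * X + 9 / 5 - (X - 9 / 5)) ≤ Real.pi * (2 * X) := mul_le_mul_of_nonneg_left hlen hπ
    have h2 : 0 ≤ Real.pi * (2 * X + 9 / 5 - (X - 9 / 5)) := mul_nonneg hπ (by linarith)
    calc Real.pi * (2 * X + 9 / 5 - (X - 9 / 5)) * (κ * (2 * X + 9 / 5) + m) ^ 2
        ≤ Real.pi * (2 * X + 9 / 5 - (X - 9 / 5)) * (2 * (2 * κ * X) ^ 2 + 2 * ((2 * κ + 1) * (9 / 5)) ^ 2) :=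
          mul_le_mul_of_nonneg_left hrad h2
      _ ≤ Real.pi * (2 * X) * (2 * (2 * κ * X) ^ 2 + 2 * ((2 * κ + 1) * (9 / 5)) ^ 2) :=
          mul_le_mul_of_nonneg_right h1 (by positivity)
  -- assemble
  have hX6 : 0 ≤ X⁻¹ ^ 6 := by positivity
  calc (∑ z ∈ T, (dist y z)⁻¹ ^ 6) * (a * (a * √3 / 2) * h)
      ≤ T.card * X⁻¹ ^ 6 * (a * (a * √3 / 2) * h) := mul_le_mul_of_nonneg_right hsum hV0
    _ = (T.card : ℝ) * (a * (a * √3 / 2) * h) * X⁻¹ ^ 6 := by ring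
    _ ≤ coneVol κ m (X - 9 / 5) (2 * X + 9 / 5) * X⁻¹ ^ 6 := mul_le_mul_of_nonneg_right hcount hX6
    _ ≤ Real.pi * (2 * X) * (2 * (2 * κ * X) ^ 2 + 2 * ((2 * κ + 1) * (9 / 5)) ^ 2) * X⁻¹ ^ 6 := mul_le_mul_of_nonneg_right hCV hX6
    _ = 16 * Real.pi * κ ^ 2 / X ^ 3 + 4 * Real.pi * ((2 * κ + 1) * (9 / 5)) ^ 2 / X ^ 5 := by
          field_simp
          ring

/-- A finite geometric sum with ratio `0 ≤ x < 1` is at most `1/(1 − x)` (private: public twins exist in unrelated namespaces). -/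
private theorem geom_sum_range_le_one_div {x : ℝ} (hx : 0 ≤ x) (hx1 : x < 1) (N : ℕ) : ∑ i ∈ Finset.range N, x ^ i ≤ 1 / (1 - x) := by
  have h := geom_sum_Ico_le_of_lt_one (m := 0) (n := N) hx hx1
  rwa [pow_zero, ← Finset.range_eq_Ico] at h

/-- ★★ THE CONE TAIL: window `(a,h)`, `g` isometry, cone of slope `κ ≥ 0` with vertex `y` about `b 2`, finite `T ⊆ g '' barlowStacking a h s`
whose members have axial part `≥ U ≥ 18/5` and radial part `≤ κ · axial` ⟹
`(Σ_{z ∈ T} (dist y z)⁻¹^6) · a(a√3/2)h ≤ (128π/7) κ²/U³ + (128π/31)((2κ + 1)·9/5)²/U⁵` (dyadic axial shells `[U2ⁿ, U2ⁿ⁺¹]`, the shell lemma,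
and `Σ 8⁻ⁿ ≤ 8/7`, `Σ 32⁻ⁿ ≤ 32/31`). -/
theorem cone_tail_sum_mul_le {a h : ℝ} {s : ℤ → ℤ} {g : E3 → E3}
    (ha : 9 / 10 ≤ a ∧ a ≤ 11 / 10) (hh : 0 < h ∧ 27 / 50 * a ^ 2 ≤ h ^ 2 ∧ h ^ 2 ≤ 121 / 150 * a ^ 2) (hg : Isometry g)
    (b : OrthonormalBasis (Fin 3) ℝ E3) (y : E3) {κ U : ℝ} (hκ : 0 ≤ κ) (hU : 18 / 5 ≤ U)
    (T : Finset E3) (hT : ↑T ⊆ g '' barlowStacking a h s)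
    (hcone : ∀ z ∈ T, U ≤ ⟪b 2, z - y⟫ ∧ ⟪b 0, z - y⟫ ^ 2 + ⟪b 1, z - y⟫ ^ 2 ≤ (κ * ⟪b 2, z - y⟫) ^ 2) :
    (∑ z ∈ T, (dist y z)⁻¹ ^ 6) * (a * (a * √3 / 2) * h) ≤
      128 * Real.pi / 7 * κ ^ 2 / U ^ 3 + 128 * Real.pi / 31 * ((2 * κ + 1) * (9 / 5)) ^ 2 / U ^ 5 := by
  have hU0 : 0 < U := by linarith
  have ha0 : 0 ≤ a := by linarith [ha.1]
  have hV0 : 0 ≤ a * (a * √3 / 2) * h := by have := hh.1.le; positivity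
  -- dyadic shell index of a target
  have hex : ∀ z ∈ T, ∃ n : ℕ, U * 2 ^ n ≤ ⟪b 2, z - y⟫ ∧ ⟪b 2, z - y⟫ ≤ U * 2 ^ (n + 1) := by
    intro z hz
    have h1 : 1 ≤ ⟪b 2, z - y⟫ / U := by rw [le_div_iff₀ hU0, one_mul]; exact (hcone z hz).1
    obtain ⟨n, hn1, hn2⟩ := exists_nat_pow_near h1 one_lt_two
    refine ⟨n, ?_, ?_⟩
    · have := (le_div_iff₀ hU0).1 hn1; linarith [this]
    · have := (div_lt_iff₀ hU0).1 hn2; linarith [this]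
  let nOf : E3 → ℕ := fun z => if hz : z ∈ T then (hex z hz).choose else 0
  have hnOf : ∀ z ∈ T, U * 2 ^ nOf z ≤ ⟪b 2, z - y⟫ ∧ ⟪b 2, z - y⟫ ≤ U * 2 ^ (nOf z + 1) := by
    intro z hz
    have e : nOf z = (hex z hz).choose := dif_pos hz
    rw [e]
    exact (hex z hz).choose_spec
  set S : Finset ℕ := T.image nOf with hS
  obtain ⟨N, hN⟩ := Finset.exists_nat_subset_range S
  -- fiberwise decomposition
  have hfib : ∑ z ∈ T, (dist y z)⁻¹ ^ 6 = ∑ n ∈ S, ∑ z ∈ T with nOf z = n, (dist y z)⁻¹ ^ 6 :=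
    (Finset.sum_fiberwise_of_maps_to (fun z hz => Finset.mem_image_of_mem nOf hz) _).symm
  -- per-fiber bound by the shell lemma with X = U 2ⁿ
  have hshell : ∀ n ∈ S, (∑ z ∈ T with nOf z = n, (dist y z)⁻¹ ^ 6) * (a * (a * √3 / 2) * h) ≤
      16 * Real.pi * κ ^ 2 / (U * 2 ^ n) ^ 3 + 4 * Real.pi * ((2 * κ + 1) * (9 / 5)) ^ 2 / (U * 2 ^ n) ^ 5 := by
    intro n hn
    have hXn : 18 / 5 ≤ U * 2 ^ n := hU.trans (le_mul_of_one_le_right hU0.le (one_le_pow₀ one_le_two))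
    refine cone_shell_sum_mul_le ha hh hg b y hκ hXn _ (subset_trans (Finset.coe_subset.2 (Finset.filter_subset _ _)) hT) ?_
    intro z hz
    rw [Finset.mem_filter] at hz
    obtain ⟨hzT, hzn⟩ := hz
    obtain ⟨h1, h2⟩ := hnOf z hzT
    rw [hzn] at h1 h2
    refine ⟨h1, ?_, (hcone z hzT).2⟩
    calc ⟪b 2, z - y⟫ ≤ U * 2 ^ (n + 1) := h2
      _ = 2 * (U * 2 ^ n) := by ring
  -- sum the geometric series
  have h8 : ∀ n : ℕ, 16 * Real.pi * κ ^ 2 / (U * 2 ^ n) ^ 3 = 16 * Real.pi * κ ^ 2 / U ^ 3 * (1 / 8) ^ n := by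
    intro n
    have e : (1 / 8 : ℝ) ^ n = 1 / (2 ^ n) ^ 3 := by
      rw [div_pow, one_pow, show (8 : ℝ) = 2 ^ 3 by norm_num, ← pow_mul, mul_comm 3 n, pow_mul]
    rw [e, mul_pow]
    field_simp
  have h32 : ∀ n : ℕ, 4 * Real.pi * ((2 * κ + 1) * (9 / 5)) ^ 2 / (U * 2 ^ n) ^ 5 =
      4 * Real.pi * ((2 * κ + 1) * (9 / 5)) ^ 2 / U ^ 5 * (1 / 32) ^ n := by
    intro n
    have e : (1 / 32 : ℝ) ^ n = 1 / (2 ^ n) ^ 5 := by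
      rw [div_pow, one_pow, show (32 : ℝ) = 2 ^ 5 by norm_num, ← pow_mul, mul_comm 5 n, pow_mul]
    rw [e, mul_pow (U) (2 ^ n) 5]
    field_simp
  have hA0 : 0 ≤ 16 * Real.pi * κ ^ 2 / U ^ 3 := by positivity
  have hB0 : 0 ≤ 4 * Real.pi * ((2 * κ + 1) * (9 / 5)) ^ 2 / U ^ 5 := by positivity
  have hterm0 : ∀ n : ℕ, 0 ≤ 16 * Real.pi * κ ^ 2 / U ^ 3 * (1 / 8) ^ n + 4 * Real.pi * ((2 * κ + 1) * (9 / 5)) ^ 2 / U ^ 5 * (1 / 32) ^ n :=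
    fun n => by positivity
  have hg8 := geom_sum_range_le_one_div (x := (1 / 8 : ℝ)) (by norm_num) (by norm_num) N
  have hg32 := geom_sum_range_le_one_div (x := (1 / 32 : ℝ)) (by norm_num) (by norm_num) N
  calc (∑ z ∈ T, (dist y z)⁻¹ ^ 6) * (a * (a * √3 / 2) * h)
      = ∑ n ∈ S, (∑ z ∈ T with nOf z = n, (dist y z)⁻¹ ^ 6) * (a * (a * √3 / 2) * h) := by rw [hfib, Finset.sum_mul]
    _ ≤ ∑ n ∈ S, (16 * Real.pi * κ ^ 2 / U ^ 3 * (1 / 8) ^ n + 4 * Real.pi * ((2 * κ + 1) * (9 / 5)) ^ 2 / U ^ 5 * (1 / 32) ^ n) := by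
          refine Finset.sum_le_sum fun n hn => ?_
          rw [← h8, ← h32]; exact hshell n hn
    _ ≤ ∑ n ∈ Finset.range N, (16 * Real.pi * κ ^ 2 / U ^ 3 * (1 / 8) ^ n +
          4 * Real.pi * ((2 * κ + 1) * (9 / 5)) ^ 2 / U ^ 5 * (1 / 32) ^ n) :=
          Finset.sum_le_sum_of_subset_of_nonneg hN fun n _ _ => hterm0 n
    _ = 16 * Real.pi * κ ^ 2 / U ^ 3 * ∑ n ∈ Finset.range N, (1 / 8 : ℝ) ^ n +
          4 * Real.pi * ((2 * κ + 1) * (9 / 5)) ^ 2 / U ^ 5 * ∑ n ∈ Finset.range N, (1 / 32 : ℝ) ^ n := by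
          rw [Finset.sum_add_distrib, Finset.mul_sum, Finset.mul_sum]
    _ ≤ 16 * Real.pi * κ ^ 2 / U ^ 3 * (1 / (1 - 1 / 8)) + 4 * Real.pi * ((2 * κ + 1) * (9 / 5)) ^ 2 / U ^ 5 * (1 / (1 - 1 / 32)) :=
          add_le_add (mul_le_mul_of_nonneg_left hg8 hA0) (mul_le_mul_of_nonneg_left hg32 hB0)
    _ = 128 * Real.pi / 7 * κ ^ 2 / U ^ 3 + 128 * Real.pi / 31 * ((2 * κ + 1) * (9 / 5)) ^ 2 / U ^ 5 := by ring

end ConeTail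

section CapAnnulus

/-- The volume of a half-space-truncated annulus: `volume (orthoCap b y t R' ∩ {ρ' ≤ dist · y}) ≤ capVol R' t − capVol ρ' t` (`−ρ' ≤ t ≤ ρ' ≤ R'`). -/
theorem volume_capAnnulus_le (b : OrthonormalBasis (Fin 3) ℝ E3) (y : E3) {t ρ' R' : ℝ} (h1 : -ρ' ≤ t) (h2 : t ≤ ρ') (h3 : ρ' ≤ R') :
    volume (orthoCap b y t R' ∩ {x | ρ' ≤ dist x y}) ≤ ENNReal.ofReal (capVol R' t) - ENNReal.ofReal (capVol ρ' t) := by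
  set C₂ : Set E3 := orthoCap b y t ρ' \ Metric.sphere y ρ' with hC₂
  have hC₂sub : C₂ ⊆ orthoCap b y t R' := by
    rintro x ⟨⟨hx1, hx2⟩, -⟩
    exact ⟨hx1, hx2.trans h3⟩
  have hdisj : Disjoint (orthoCap b y t R' ∩ {x | ρ' ≤ dist x y}) C₂ := by
    rw [Set.disjoint_left]
    rintro x ⟨-, hx⟩ ⟨⟨-, hx2⟩, hx3⟩
    apply hx3
    rw [Metric.mem_sphere]
    exact le_antisymm hx2 hx
  have hC₂m : MeasurableSet C₂ := (measurableSet_orthoCap b y t ρ').diff Metric.isClosed_sphere.measurableSet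
  have hC₂vol : volume C₂ = ENNReal.ofReal (capVol ρ' t) := by
    rw [hC₂, measure_sdiff_null (Measure.addHaar_sphere volume y ρ'), volume_orthoCap_eq b y h1 h2]
  have hsum : volume (orthoCap b y t R' ∩ {x | ρ' ≤ dist x y}) + volume C₂ ≤ ENNReal.ofReal (capVol R' t) := by
    rw [← measure_union hdisj hC₂m, ← volume_orthoCap_eq b y (h1.trans' (by linarith)) (h2.trans h3)]
    exact measure_mono (Set.union_subset Set.inter_subset_left hC₂sub)
  rw [hC₂vol] at hsum
  exact ENNReal.le_sub_of_add_le_right ENNReal.ofReal_ne_top hsum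

/-- ★★ THE HALF-ANNULUS COUNT (inside regime `r < a ≤ 2r` of the certificate: targets at distance `∈ [R₁, R₂]` from the source on the forward
side of an axial level `τ`): window `(a,h)`, `g` isometry, finite `T ⊆ g '' barlowStacking a h s` with `τ ≤ ⟪b 2, z − y⟫`, `R₁ ≤ dist z y ≤ R₂`
on `T`, and `−(R₁ − 9/5) ≤ τ − 9/5 ≤ R₁ − 9/5`, `R₁ ≤ R₂` ⟹ `#T · a(a√3/2)h ≤ capVol (R₂ + 9/5) (τ − 9/5) − capVol (R₁ − 9/5) (τ − 9/5)`
(for `τ = 0`: the exact volume `(2π/3)((R₂ + 9/5)³ − (R₁ − 9/5)³) + π·(9/5)·((R₂ + 9/5)² − (R₁ − 9/5)²)` of the thickened half-annulus). -/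
theorem card_mul_le_capAnnulus_of_subset_image {a h : ℝ} {s : ℤ → ℤ} {g : E3 → E3}
    (ha : 9 / 10 ≤ a ∧ a ≤ 11 / 10) (hh : 0 < h ∧ 27 / 50 * a ^ 2 ≤ h ^ 2 ∧ h ^ 2 ≤ 121 / 150 * a ^ 2) (hg : Isometry g)
    (b : OrthonormalBasis (Fin 3) ℝ E3) (y : E3) {τ R₁ R₂ : ℝ} (hR : R₁ ≤ R₂) (hτ1 : -(R₁ - 9 / 5) ≤ τ - 9 / 5) (hτ2 : τ - 9 / 5 ≤ R₁ - 9 / 5)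
    (T : Finset E3) (hT : ↑T ⊆ g '' barlowStacking a h s) (hTτ : ∀ z ∈ T, τ ≤ ⟪b 2, z - y⟫) (hT1 : ∀ z ∈ T, R₁ ≤ dist z y)
    (hT2 : ∀ z ∈ T, dist z y ≤ R₂) :
    (T.card : ℝ) * (a * (a * √3 / 2) * h) ≤ capVol (R₂ + 9 / 5) (τ - 9 / 5) - capVol (R₁ - 9 / 5) (τ - 9 / 5) := by
  have ha0 : 0 ≤ a := by linarith [ha.1]
  have hV0 : 0 ≤ a * (a * √3 / 2) * h := by have := hh.1.le; positivity
  set K : Set E3 := {z | τ ≤ ⟪b 2, z - y⟫ ∧ R₁ ≤ dist z y ∧ dist z y ≤ R₂} with hK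
  have hT' : ↑T ⊆ g '' barlowStacking a h s ∩ K := fun z hz =>
    ⟨hT hz, hTτ z (Finset.mem_coe.1 hz), hT1 z (Finset.mem_coe.1 hz), hT2 z (Finset.mem_coe.1 hz)⟩
  have c1 := card_mul_le_volume_near_of_subset_image ha hh hg K T hT'
  have hn2 : ‖b 2‖ = 1 := b.orthonormal.1 2
  have c2 : {x : E3 | ∃ z ∈ K, dist x z ≤ 9 / 5} ⊆ orthoCap b y (τ - 9 / 5) (R₂ + 9 / 5) ∩ {x | R₁ - 9 / 5 ≤ dist x y} := by
    rintro x ⟨z, ⟨hz1, hz2, hz3⟩, hxz⟩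
    have hax : |⟪b 2, x - z⟫| ≤ 9 / 5 := by
      calc |⟪b 2, x - z⟫| ≤ ‖b 2‖ * ‖x - z‖ := abs_real_inner_le_norm _ _
        _ = dist x z := by rw [hn2, one_mul, dist_eq_norm]
        _ ≤ 9 / 5 := hxz
    have hax' := (abs_le.1 hax).1
    have hsplit : ⟪b 2, x - y⟫ = ⟪b 2, z - y⟫ + ⟪b 2, x - z⟫ := by
      rw [← inner_add_right]; congr 1; abel
    have hd1 := dist_triangle x z y
    have hd2 := dist_triangle z x y
    rw [dist_comm z x] at hd2
    refine ⟨⟨by rw [hsplit]; linarith, by linarith⟩, ?_⟩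
    show R₁ - 9 / 5 ≤ dist x y
    linarith
  have c3 := (c1.trans (measure_mono c2)).trans (volume_capAnnulus_le b y hτ1 hτ2 (by linarith))
  have hnn2 : 0 ≤ capVol (R₁ - 9 / 5) (τ - 9 / 5) := capVol_nonneg (by linarith)
  have hnn1 : 0 ≤ capVol (R₂ + 9 / 5) (τ - 9 / 5) := capVol_nonneg (by linarith)
  have hle : capVol (R₁ - 9 / 5) (τ - 9 / 5) ≤ capVol (R₂ + 9 / 5) (τ - 9 / 5) := by
    have hsub : orthoCap b y (τ - 9 / 5) (R₁ - 9 / 5) ⊆ orthoCap b y (τ - 9 / 5) (R₂ + 9 / 5) := fun x hx => ⟨hx.1, hx.2.trans (by linarith)⟩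
    have hv := measure_mono (μ := volume) hsub
    rw [volume_orthoCap_eq b y hτ1 hτ2, volume_orthoCap_eq b y (hτ1.trans' (by linarith)) (hτ2.trans (by linarith)),
      ENNReal.ofReal_le_ofReal_iff hnn1] at hv
    exact hv
  rw [← ENNReal.ofReal_sub _ hnn2, ← ENNReal.ofReal_natCast, ← ENNReal.ofReal_mul (Nat.cast_nonneg _),
    ENNReal.ofReal_le_ofReal_iff (sub_nonneg.2 hle)] at c3
  exact c3

end CapAnnulus

end Summit.AtomisticToContinuum.Crystallization.Theorems.ChargedEnergyGapChartDial

end
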